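import Summits.MatrixMultiplication.MatrixMultiplication.Theses.FourierTwoFamiliesModP

/-!
# `PrimeDensityDecay` (crux stmt-MatrixMultiplication-14311), line `collision-profile-removal`:
# negative-side facts about its four stubs (drefute seat; everything `sorry`-free, Mathlib + route file only)

The stub statements of `Cruxes/PrimeDensityDecay/Lines/collision-profile-removal.lean` are restated VERBATIM
(`coincidences`, `mass`, `privDiff`, `LowCollisionDecay`, `MassConcentration`, `HereditaryBias`,
`ConcentratedCoreDecay`) so that this file does not import the sorried skeleton.

* `concentratedCoreDecay_of_primeDensityDecay` — the open core (stub 4) is IMPLIED by the crux (drop its three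
  extra hypotheses).  With the skeleton's sorry-free glue (stubs 1–3 ∧ stub 4 ⇒ crux) the core is the crux modulo
  three provable lemmas: a refutation of stub 4 would be a refutation of `PrimeDensityDecay` itself.
* `hereditaryBias_false_without_X` — stub 3 with (X) deleted is FALSE (`p = 3`, `A i = {i}`, `B i = {-i}`,
  `Z = univ`: bound `2 ≤ ‖∑_z ψ z‖ = 0`).  Any proof of stub 3 must use (X) (it needs neither (W) nor `s ≥ s₀`).
* `massConcentration_false_without_W` — stub 2 with (W) deleted is FALSE (one pair `A = B = ℤ/p`: the matched
  mass is flat, `mass R = p·|R|`, so `(1 − 2η)p ≤ |R| ≤ ηp` fails for `η = 1/4`).  Any proof of stub 2 must use (W).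
* `lowCollisionDecay_false_without_W` — stub 1's conclusion `LowCollisionDecay` with (W) deleted is FALSE (same
  pair: `coincidences = p³ ≤ 1·s·(n s²)` puts it in the LOW-collision regime `K = 1` at density 1).
-/

namespace Summit.MatrixMultiplication.MatrixMultiplication.Theorems.PrimeDensityDecay.Negative.CollisionProfileRemoval

open scoped BigOperators Pointwise
open Finset
open Summit.MatrixMultiplication.MatrixMultiplication.Theses.FourierTwoFamiliesModP

/-! ## The line's statistics and stub statements (verbatim from the skeleton) -/

/-- `Σ_d D(d)²` (verbatim `CollisionProfileRemoval.coincidences`). -/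
def coincidences {p n : ℕ} (A B : Fin n → Finset (ZMod p)) : ℕ :=
  ∑ i, ∑ j, (((A i ×ˢ B i) ×ˢ (A j ×ˢ B j)).filter fun q => q.1.1 - q.1.2 = q.2.1 - q.2.2).card

/-- matched mass on `R` (verbatim `CollisionProfileRemoval.mass`). -/
def mass {p n : ℕ} (A B : Fin n → Finset (ZMod p)) (R : Finset (ZMod p)) : ℕ :=
  ∑ i, ((A i ×ˢ B i).filter fun q => q.1 - q.2 ∈ R).card

/-- `X₀ = ⋃ᵢ (A i − B i)` (verbatim `CollisionProfileRemoval.privDiff`). -/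
def privDiff {p n : ℕ} (A B : Fin n → Finset (ZMod p)) : Finset (ZMod p) :=
  Finset.univ.biUnion fun i => A i - B i

/-- verbatim `CollisionProfileRemoval.LowCollisionDecay` (stub 1's conclusion). -/
def LowCollisionDecay : Prop :=
  ∀ (K : ℕ) (ε : ℝ), 0 < ε → ∃ s₀ : ℕ, ∀ p : ℕ, p.Prime → ∀ (n s : ℕ) (A B : Fin n → Finset (ZMod p)),
    s₀ ≤ s → (∀ i : Fin n, (A i).card = s ∧ (B i).card = s) →
    (∀ i : Fin n, ∀ a ∈ A i, ∀ a' ∈ A i, ∀ b ∈ B i, ∀ b' ∈ B i, (a - a') + (b - b') = 0 → a = a' ∧ b = b') →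
    (∀ i j k : Fin n, ∀ a ∈ A i, ∀ a' ∈ A j, ∀ b ∈ B j, ∀ b' ∈ B k, (a - a') + (b - b') = 0 → i = k) →
    coincidences A B ≤ K * s * (n * s ^ 2) →
    (n : ℝ) * (s : ℝ) ≤ ε * (p : ℝ)

/-- verbatim `CollisionProfileRemoval.MassConcentration` (stub 2). -/
def MassConcentration : Prop :=
  ∀ η : ℝ, 0 < η → ∃ s₀ : ℕ, ∀ p : ℕ, p.Prime → ∀ (n s : ℕ) (A B : Fin n → Finset (ZMod p)),
    s₀ ≤ s → (∀ i : Fin n, (A i).card = s ∧ (B i).card = s) →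
    (∀ i : Fin n, ∀ a ∈ A i, ∀ a' ∈ A i, ∀ b ∈ B i, ∀ b' ∈ B i, (a - a') + (b - b') = 0 → a = a' ∧ b = b') →
    (∀ i j k : Fin n, ∀ a ∈ A i, ∀ a' ∈ A j, ∀ b ∈ B j, ∀ b' ∈ B k, (a - a') + (b - b') = 0 → i = k) →
    ∃ R : Finset (ZMod p), R ⊆ privDiff A B ∧ (R.card : ℝ) ≤ η * (p : ℝ) ∧
      (n : ℝ) * (s : ℝ) ^ 2 - 2 * η * (p : ℝ) * (s : ℝ) ≤ (mass A B R : ℝ)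

/-- verbatim `CollisionProfileRemoval.HereditaryBias` (stub 3). -/
def HereditaryBias : Prop :=
  ∀ p : ℕ, p.Prime → ∀ (n s : ℕ) (A B : Fin n → Finset (ZMod p)),
    (∀ i : Fin n, (A i).card = s ∧ (B i).card = s) →
    (∀ i j k : Fin n, ∀ a ∈ A i, ∀ a' ∈ A j, ∀ b ∈ B j, ∀ b' ∈ B k, (a - a') + (b - b') = 0 → i = k) →
    ∀ Z : Finset (ZMod p), Z ⊆ privDiff A B →
      ∃ ψ : AddChar (ZMod p) ℂ, ψ ≠ 1 ∧
        (n : ℝ) * (s : ℝ) / (p : ℝ) * (Z.card : ℝ) - (s : ℝ) ≤ ‖∑ z ∈ Z, ψ z‖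

/-- verbatim `CollisionProfileRemoval.ConcentratedCoreDecay` (stub 4, the open core). -/
def ConcentratedCoreDecay : Prop :=
  ∀ ε : ℝ, 0 < ε → ∃ (K : ℕ) (η : ℝ) (s₀ : ℕ), 0 < η ∧
    ∀ p : ℕ, p.Prime → ∀ (n s : ℕ) (A B : Fin n → Finset (ZMod p)),
    s₀ ≤ s → (∀ i : Fin n, (A i).card = s ∧ (B i).card = s) →
    (∀ i : Fin n, ∀ a ∈ A i, ∀ a' ∈ A i, ∀ b ∈ B i, ∀ b' ∈ B i, (a - a') + (b - b') = 0 → a = a' ∧ b = b') →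
    (∀ i j k : Fin n, ∀ a ∈ A i, ∀ a' ∈ A j, ∀ b ∈ B j, ∀ b' ∈ B k, (a - a') + (b - b') = 0 → i = k) →
    K * s * (n * s ^ 2) < coincidences A B →
    (∃ R : Finset (ZMod p), R ⊆ privDiff A B ∧ (R.card : ℝ) ≤ η * (p : ℝ) ∧
      (n : ℝ) * (s : ℝ) ^ 2 - 2 * η * (p : ℝ) * (s : ℝ) ≤ (mass A B R : ℝ)) →
    (∀ Z : Finset (ZMod p), Z ⊆ privDiff A B →
      ∃ ψ : AddChar (ZMod p) ℂ, ψ ≠ 1 ∧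
        (n : ℝ) * (s : ℝ) / (p : ℝ) * (Z.card : ℝ) - (s : ℝ) ≤ ‖∑ z ∈ Z, ψ z‖) →
    (n : ℝ) * (s : ℝ) ≤ ε * (p : ℝ)

/-! ## Stub 4 is implied by the crux -/

/-- The open core follows from the crux by discarding its three extra hypotheses (`K = 0`, `η = 1`).  Hence, given
the skeleton's sorry-free glue `LowCollisionDecay → MassConcentration → HereditaryBias → ConcentratedCoreDecay →
PrimeDensityDecay`, stub 4 is EQUIVALENT to the crux modulo the three provable stubs. -/
theorem concentratedCoreDecay_of_primeDensityDecay (h : PrimeDensityDecay) : ConcentratedCoreDecay := by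
  intro ε hε
  obtain ⟨s₀, hs₀⟩ := h ε hε
  refine ⟨0, 1, s₀, one_pos, ?_⟩
  intro p hp n s A B hs hcard hW hX _ _ _
  exact hs₀ p hp n s A B hs hcard hW hX

/-! ## Stub 3 needs (X) -/

/-- `HereditaryBias` with the cross hypothesis (X) deleted (everything else verbatim). -/
def HereditaryBiasWithoutX : Prop :=
  ∀ p : ℕ, p.Prime → ∀ (n s : ℕ) (A B : Fin n → Finset (ZMod p)),
    (∀ i : Fin n, (A i).card = s ∧ (B i).card = s) →
    ∀ Z : Finset (ZMod p), Z ⊆ privDiff A B →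
      ∃ ψ : AddChar (ZMod p) ℂ, ψ ≠ 1 ∧
        (n : ℝ) * (s : ℝ) / (p : ℝ) * (Z.card : ℝ) - (s : ℝ) ≤ ‖∑ z ∈ Z, ψ z‖

/-- Witness `p = 3, n = 3, s = 1, A i = {i}, B i = {-i}, Z = univ`: the private differences `2i` cover `ZMod 3`,
so the bound asks `3·1/3·3 − 1 = 2 ≤ ‖∑_z ψ z‖ = 0` for a nontrivial `ψ`.  Any proof of stub 3 must use (X). -/
theorem hereditaryBias_false_without_X : ¬ HereditaryBiasWithoutX := by
  intro h
  obtain ⟨ψ, hψ, hle⟩ := h 3 (by norm_num) 3 1 (fun i => {((i : ℕ) : ZMod 3)}) (fun i => {-((i : ℕ) : ZMod 3)})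
    (by intro i; simp) Finset.univ (by decide)
  have hsum : ∑ z ∈ (Finset.univ : Finset (ZMod 3)), ψ z = 0 := AddChar.sum_eq_zero_of_ne_one hψ
  rw [hsum, norm_zero, Finset.card_univ, ZMod.card] at hle
  norm_num at hle

/-! ## Stubs 1–2 need (W) -/

/-- The matched mass of the single pair `A = B = ℤ/p` is flat: `mass R = p · |R|`. -/
theorem mass_univ_pair {p : ℕ} [NeZero p] (R : Finset (ZMod p)) :
    mass (fun _ : Fin 1 => (Finset.univ : Finset (ZMod p))) (fun _ : Fin 1 => Finset.univ) R = p * R.card := by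
  unfold mass
  simp only [Finset.univ_unique, Finset.sum_singleton]
  have : ((Finset.univ ×ˢ Finset.univ).filter fun q : ZMod p × ZMod p => q.1 - q.2 ∈ R).card
      = (Finset.univ ×ˢ R : Finset (ZMod p × ZMod p)).card := by
    apply Finset.card_nbij' (fun q => (q.2, q.1 - q.2)) (fun r => (r.2 + r.1, r.1))
    · intro q hq
      simp only [Finset.mem_coe, Finset.mem_filter, Finset.mem_product, Finset.mem_univ, true_and] at hq ⊢
      exact hq
    · intro r hr
      simp only [Finset.mem_coe, Finset.mem_filter, Finset.mem_product, Finset.mem_univ, true_and] at hr ⊢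
      simpa using hr
    · intro q _
      simp
    · intro r _
      simp
  rw [this, Finset.card_product, Finset.card_univ, ZMod.card]

/-- `MassConcentration` with the directness hypothesis (W) deleted (everything else verbatim). -/
def MassConcentrationWithoutW : Prop :=
  ∀ η : ℝ, 0 < η → ∃ s₀ : ℕ, ∀ p : ℕ, p.Prime → ∀ (n s : ℕ) (A B : Fin n → Finset (ZMod p)),
    s₀ ≤ s → (∀ i : Fin n, (A i).card = s ∧ (B i).card = s) →
    (∀ i j k : Fin n, ∀ a ∈ A i, ∀ a' ∈ A j, ∀ b ∈ B j, ∀ b' ∈ B k, (a - a') + (b - b') = 0 → i = k) →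
    ∃ R : Finset (ZMod p), R ⊆ privDiff A B ∧ (R.card : ℝ) ≤ η * (p : ℝ) ∧
      (n : ℝ) * (s : ℝ) ^ 2 - 2 * η * (p : ℝ) * (s : ℝ) ≤ (mass A B R : ℝ)

/-- (W) is load-bearing for stub 2: for `η = 1/4` and the pair `A = B = ℤ/p` (n = 1, s = p ≥ s₀, (X) vacuous for
one index) the conclusion needs `p² − p²/2 ≤ mass R = p|R| ≤ p²/4`. -/
theorem massConcentration_false_without_W : ¬ MassConcentrationWithoutW := by
  intro h
  obtain ⟨s₀, hs₀⟩ := h (1 / 4) (by norm_num)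
  obtain ⟨p, hp_ge, hp⟩ := Nat.exists_infinite_primes (max s₀ 2)
  haveI : NeZero p := ⟨hp.ne_zero⟩
  have hX : ∀ i j k : Fin 1, ∀ a ∈ (fun _ : Fin 1 => (Finset.univ : Finset (ZMod p))) i,
      ∀ a' ∈ (fun _ : Fin 1 => (Finset.univ : Finset (ZMod p))) j,
      ∀ b ∈ (fun _ : Fin 1 => (Finset.univ : Finset (ZMod p))) j,
      ∀ b' ∈ (fun _ : Fin 1 => (Finset.univ : Finset (ZMod p))) k,
      (a - a') + (b - b') = 0 → i = k := fun i j k _ _ _ _ _ _ _ _ _ => Subsingleton.elim i k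
  have hcard : ∀ i : Fin 1, ((fun _ : Fin 1 => (Finset.univ : Finset (ZMod p))) i).card = p ∧
      ((fun _ : Fin 1 => (Finset.univ : Finset (ZMod p))) i).card = p := fun i => by
    simp [Finset.card_univ, ZMod.card]
  obtain ⟨R, -, hRcard, hmass⟩ := hs₀ p hp 1 p (fun _ => Finset.univ) (fun _ => Finset.univ)
    (le_trans (le_max_left _ _) hp_ge) hcard hX
  rw [mass_univ_pair] at hmass
  have hp0 : (0 : ℝ) < p := by exact_mod_cast hp.pos
  push_cast at hmass
  -- hmass : p * p^2 - 2 * (1/4) * p * p ≤ p * |R| ;  hRcard : |R| ≤ p/4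
  have h1 : (p : ℝ) * (R.card : ℝ) ≤ (p : ℝ) * ((1 / 4) * p) := mul_le_mul_of_nonneg_left hRcard hp0.le
  nlinarith [mul_pos hp0 hp0]

/-- `LowCollisionDecay` with (W) deleted (everything else verbatim). -/
def LowCollisionDecayWithoutW : Prop :=
  ∀ (K : ℕ) (ε : ℝ), 0 < ε → ∃ s₀ : ℕ, ∀ p : ℕ, p.Prime → ∀ (n s : ℕ) (A B : Fin n → Finset (ZMod p)),
    s₀ ≤ s → (∀ i : Fin n, (A i).card = s ∧ (B i).card = s) →
    (∀ i j k : Fin n, ∀ a ∈ A i, ∀ a' ∈ A j, ∀ b ∈ B j, ∀ b' ∈ B k, (a - a') + (b - b') = 0 → i = k) →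
    coincidences A B ≤ K * s * (n * s ^ 2) →
    (n : ℝ) * (s : ℝ) ≤ ε * (p : ℝ)

/-- The collision number of the single pair `A = B = ℤ/p` is at most `p³` (in fact equal): the quadruples
`((a,b),(a',b'))` with `a − b = a' − b'` are determined by `(a, b, a')`. -/
theorem coincidences_univ_pair_le {p : ℕ} [NeZero p] :
    coincidences (fun _ : Fin 1 => (Finset.univ : Finset (ZMod p))) (fun _ : Fin 1 => Finset.univ) ≤ p ^ 3 := by
  unfold coincidences
  simp only [Finset.univ_unique, Finset.sum_singleton]
  set F := (((Finset.univ : Finset (ZMod p)) ×ˢ (Finset.univ : Finset (ZMod p))) ×ˢ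
      ((Finset.univ : Finset (ZMod p)) ×ˢ (Finset.univ : Finset (ZMod p)))).filter
      fun q => q.1.1 - q.1.2 = q.2.1 - q.2.2 with hF
  have hinj : Set.InjOn (fun q : (ZMod p × ZMod p) × (ZMod p × ZMod p) => (q.1.1, q.1.2, q.2.1)) F := by
    intro q hq q' hq' hqq
    simp only [hF, Finset.coe_filter, Set.mem_setOf_eq, Finset.mem_product, Finset.mem_univ, true_and] at hq hq'
    simp only [Prod.mk.injEq] at hqq
    obtain ⟨h1, h2, h3⟩ := hqq
    have h4 : q.2.2 = q'.2.2 := by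
      have e1 : q.2.2 = q.2.1 - (q.1.1 - q.1.2) := by rw [hq]; ring
      have e2 : q'.2.2 = q'.2.1 - (q'.1.1 - q'.1.2) := by rw [hq']; ring
      rw [e1, e2, h1, h2, h3]
    ext <;> assumption
  have hle := Finset.card_le_card_of_injOn (fun q : (ZMod p × ZMod p) × (ZMod p × ZMod p) => (q.1.1, q.1.2, q.2.1))
    (fun q _ => Finset.mem_univ _) hinj
  calc F.card ≤ (Finset.univ : Finset (ZMod p × ZMod p × ZMod p)).card := hle
    _ = p ^ 3 := by simp [Finset.card_univ, ZMod.card]; ring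

/-- (W) is load-bearing for stub 1's conclusion: without it the pair `A = B = ℤ/p` (n = 1, s = p) is in the
LOW-collision regime with `K = 1` (`coincidences ≤ p³ = 1·s·(n s²)`) at density 1 > ε = 1/2. -/
theorem lowCollisionDecay_false_without_W : ¬ LowCollisionDecayWithoutW := by
  intro h
  obtain ⟨s₀, hs₀⟩ := h 1 (1 / 2) (by norm_num)
  obtain ⟨p, hp_ge, hp⟩ := Nat.exists_infinite_primes (max s₀ 2)
  haveI : NeZero p := ⟨hp.ne_zero⟩
  have hX : ∀ i j k : Fin 1, ∀ a ∈ (fun _ : Fin 1 => (Finset.univ : Finset (ZMod p))) i,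
      ∀ a' ∈ (fun _ : Fin 1 => (Finset.univ : Finset (ZMod p))) j,
      ∀ b ∈ (fun _ : Fin 1 => (Finset.univ : Finset (ZMod p))) j,
      ∀ b' ∈ (fun _ : Fin 1 => (Finset.univ : Finset (ZMod p))) k,
      (a - a') + (b - b') = 0 → i = k := fun i j k _ _ _ _ _ _ _ _ _ => Subsingleton.elim i k
  have hcard : ∀ i : Fin 1, ((fun _ : Fin 1 => (Finset.univ : Finset (ZMod p))) i).card = p ∧
      ((fun _ : Fin 1 => (Finset.univ : Finset (ZMod p))) i).card = p := fun i => by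
    simp [Finset.card_univ, ZMod.card]
  have hco : coincidences (fun _ : Fin 1 => (Finset.univ : Finset (ZMod p))) (fun _ : Fin 1 => Finset.univ)
      ≤ 1 * p * (1 * p ^ 2) := by
    have := coincidences_univ_pair_le (p := p)
    calc _ ≤ p ^ 3 := this
      _ = 1 * p * (1 * p ^ 2) := by ring
  have key := hs₀ p hp 1 p (fun _ => Finset.univ) (fun _ => Finset.univ) (le_trans (le_max_left _ _) hp_ge) hcard hX hco
  have hp0 : (0 : ℝ) < p := by exact_mod_cast hp.pos
  push_cast at key
  linarith

end Summit.MatrixMultiplication.MatrixMultiplication.Theorems.PrimeDensityDecay.Negative.CollisionProfileRemoval
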